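import Summits.CriticalPhenomena.SAWScalingLimit.Theorems.SAWLeftRightFKGFKGToTraversalBoundNecklaceCarrier
import HarnessLib

/-!
# Necklace assembly (far-tip form), part 4: attaching the defect set of a tame presentation

Crux `SAWLeftRightFKG.FKGToTraversalBound` (stmt-CriticalPhenomena-1878), line `slit-necklace`
(reshape r4), stub `stub_necklaceAssemblyFar`, step A2 of the chart
`Cruxes/FKGToTraversalBound/Lines/slit-necklace-chart-r4.md` §3.

A tame presentation (`TamePresentation Ω δ N₀`) gives a boundary walk `C` and a defect set `S`, `#S ≤ N₀`,
with the graph identity `(dom C δ)_δ = Ω_δ ∖ S` — and nothing else about `S`.  The slot law and the far-tip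
witness consume an ATTACHED spine: every spine site joined to the trace of `C` by a lattice walk through spine
sites and trace sites; and the spine-blob lemma (`stub_necklaceSpine`) wants the chord's endpoint off `S` with a
neighbour off `S`.  This file normalises `S` (`tamePresentation_attached`): there is a defect set `S'`,
`#S' ≤ 5 #S`, with the SAME graph identity, CLOSED (every site off `S'` with an edge of `Ω_δ` has a neighbour
off `S'`), and EITHER attached, OR swallowing a whole connected piece of `Ω_δ` (some non-isolated vertex all of
whose `Ω_δ`-reachable vertices lie in `S'` — for small mesh `Ω_δ` is connected, so this degenerate alternative
forces the chord to have at most `#S'` vertices).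

Construction.  `S₁ := S ∪ {y ∉ S non-isolated with all Ω_δ-neighbours in S}` (at most `4 #S` new sites, each
a lattice neighbour of a site of `S`; the identity is unchanged because every edge at a new site already
touches `S`; closedness: a site off `S₁` all of whose neighbours lie in `S₁` has them in `S`, so it is new);
`S₂ := ` the sites of `S₁` with an edge of `Ω_δ` (isolated sites carry no edge).  A site of `S₂` with a
neighbour `y ∉ S₂` is a TRACE site: `y` has a neighbour `z ∉ S₂` (closedness), `y ∼ z` in `(dom C δ)_δ`
(identity), and the trace dichotomy `adj_or_mem_support` at the non-isolated vertex `y` applies.  If every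
site of `S₂` is joined inside `S₂` (along edges of `Ω_δ ≤ ℤ²`) to such a site, `S₂` is attached; otherwise the
`S₂`-internal component of some site is closed under `Ω_δ`-adjacency, i.e. a whole reachability class.

Only theorems; no named fact; axioms are the standard three.
-/

noncomputable section

open Set Metric
open Literature.Probability.LatticeModels
open Literature.Probability.RandomPlanarGeometry
open Summit.CriticalPhenomena.SAWScalingLimit.Theorems.FKGToTraversalBound.Negative (dom)
open Summit.CriticalPhenomena.SAWScalingLimit.Theorems.FKGToTraversalBound.GatesByBubbleDoorsByFKG
  (adj_or_mem_support)

namespace Summit.CriticalPhenomena.SAWScalingLimit.Theorems.FKGToTraversalBound.SlitNecklace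

/-- **Step 1–2 of the normalisation.**  From a defect set `S` with the graph identity: a defect set `S₂`,
`#S₂ ≤ 5 #S`, with the same identity, closed, and all of whose sites carry an edge of `Ω_δ`. [folklore] -/
private theorem tamePresentation_close (Ω : Set ℂ) (δ : ℝ) {c : Site 2} (C : (zdGraph 2).Walk c c)
    (S : Finset (Site 2))
    (hid : ∀ x y : Site 2, (discreteDomainGraph (dom C δ) δ).Adj x y ↔
      ((discreteDomainGraph Ω δ).Adj x y ∧ x ∉ S ∧ y ∉ S)) :
    ∃ S₂ : Finset (Site 2), S₂.card ≤ 5 * S.card ∧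
      (∀ x y : Site 2, (discreteDomainGraph (dom C δ) δ).Adj x y ↔
        ((discreteDomainGraph Ω δ).Adj x y ∧ x ∉ S₂ ∧ y ∉ S₂)) ∧
      (∀ y w : Site 2, y ∉ S₂ → (discreteDomainGraph Ω δ).Adj y w →
        ∃ w', (discreteDomainGraph Ω δ).Adj y w' ∧ w' ∉ S₂) ∧
      (∀ s ∈ S₂, ∃ w, (discreteDomainGraph Ω δ).Adj s w) := by
  classical
  set G := discreteDomainGraph Ω δ with hG
  have hle : G ≤ zdGraph 2 := (discreteDomainGraph_le_meshGraph Ω δ).trans (meshGraph_le_zdGraph Ω δ)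
  -- the new sites: off `S`, non-isolated, all neighbours in `S`
  set Nw : Finset (Site 2) := (S.biUnion fun s => (zdGraph 2).neighborFinset s).filter
    fun y => y ∉ S ∧ (∃ w, G.Adj y w) ∧ ∀ w, G.Adj y w → w ∈ S with hNw
  have hmemNw : ∀ y, y ∈ Nw ↔ y ∉ S ∧ (∃ w, G.Adj y w) ∧ ∀ w, G.Adj y w → w ∈ S := by
    intro y
    simp only [hNw, Finset.mem_filter, Finset.mem_biUnion, SimpleGraph.mem_neighborFinset,
      and_iff_right_iff_imp]
    rintro ⟨-, ⟨w, hw⟩, hall⟩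
    exact ⟨w, hall w hw, hle hw.symm⟩
  set S₁ := S ∪ Nw with hS₁
  have hcard₁ : S₁.card ≤ 5 * S.card := by
    have h1 : Nw.card ≤ 4 * S.card := by
      refine (Finset.card_filter_le _ _).trans (Finset.card_biUnion_le.trans ?_)
      rw [Finset.sum_congr rfl fun s _ => card_neighborFinset_zdGraph_holds (d := 2) s,
        Finset.sum_const, smul_eq_mul]
      omega
    have h2 : S₁.card ≤ S.card + Nw.card := Finset.card_union_le S Nw
    omega
  have hmemS₁ : ∀ y, y ∈ S₁ ↔ y ∈ S ∨ y ∈ Nw := fun y => Finset.mem_union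
  -- identity for `S₁`
  have hid₁ : ∀ x y : Site 2, (discreteDomainGraph (dom C δ) δ).Adj x y ↔ (G.Adj x y ∧ x ∉ S₁ ∧ y ∉ S₁) := by
    intro x y
    rw [hid x y, hmemS₁, hmemS₁]
    constructor
    · rintro ⟨hxy, hx, hy⟩
      refine ⟨hxy, ?_, ?_⟩
      · rintro (h | h)
        · exact hx h
        · exact hy (((hmemNw x).1 h).2.2 y hxy)
      · rintro (h | h)
        · exact hy h
        · exact hx (((hmemNw y).1 h).2.2 x hxy.symm)
    · rintro ⟨hxy, hx, hy⟩
      exact ⟨hxy, fun h => hx (Or.inl h), fun h => hy (Or.inl h)⟩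
  -- closedness of `S₁`
  have hcl₁ : ∀ y w : Site 2, y ∉ S₁ → G.Adj y w → ∃ w', G.Adj y w' ∧ w' ∉ S₁ := by
    intro y w hy hyw
    by_contra hall
    simp only [not_exists, not_and, not_not] at hall
    rw [hmemS₁, not_or] at hy
    -- all neighbours of `y` lie in `S`
    have hallS : ∀ w', G.Adj y w' → w' ∈ S := by
      intro w' hw'
      rcases (hmemS₁ w').1 (hall w' hw') with h | h
      · exact h
      · exact absurd (((hmemNw w').1 h).2.2 y hw'.symm) hy.1
    exact hy.2 ((hmemNw y).2 ⟨hy.1, ⟨w, hyw⟩, hallS⟩)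
  -- drop the isolated sites
  set S₂ := S₁.filter fun s => ∃ w, G.Adj s w with hS₂
  have hmemS₂ : ∀ y, y ∈ S₂ ↔ y ∈ S₁ ∧ ∃ w, G.Adj y w := fun y => Finset.mem_filter
  refine ⟨S₂, (Finset.card_filter_le _ _).trans hcard₁, fun x y => ?_, fun y w hy hyw => ?_, fun s hs => ?_⟩
  · rw [hid₁ x y, hmemS₂, hmemS₂]
    constructor
    · rintro ⟨hxy, hx, hy⟩
      exact ⟨hxy, fun h => hx h.1, fun h => hy h.1⟩
    · rintro ⟨hxy, hx, hy⟩
      exact ⟨hxy, fun h => hx ⟨h, y, hxy⟩, fun h => hy ⟨h, x, hxy.symm⟩⟩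
  · have hy₁ : y ∉ S₁ := fun h => hy ((hmemS₂ y).2 ⟨h, w, hyw⟩)
    obtain ⟨w', hw', hw'S⟩ := hcl₁ y w hy₁ hyw
    exact ⟨w', hw', fun h => hw'S ((hmemS₂ w').1 h).1⟩
  · exact ((hmemS₂ s).1 hs).2

/-- **Registered part of `stub_necklaceAssemblyFar`: attaching the defect set.**  For `δ ≠ 0`, a boundary walk
`C` and a defect set `S` presenting `(dom C δ)_δ` as `Ω_δ ∖ S`, there is a defect set `S'` with `#S' ≤ 5 #S`,
the same graph identity, CLOSED (a site off `S'` with an edge of `Ω_δ` has a neighbour off `S'`), and either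
ATTACHED (every site of `S'` is joined to the trace of `C` by a lattice walk through `S'` and the trace) or
SWALLOWING a whole piece of `Ω_δ` (some non-isolated vertex all of whose `Ω_δ`-reachable vertices lie in
`S'`). [folklore] -/
theorem tamePresentation_attached : ∀ (Ω : Set ℂ) (δ : ℝ) (c : Site 2) (C : (zdGraph 2).Walk c c)
    (S : Finset (Site 2)), δ ≠ 0 →
    (∀ x y : Site 2, (discreteDomainGraph (dom C δ) δ).Adj x y ↔
      ((discreteDomainGraph Ω δ).Adj x y ∧ x ∉ S ∧ y ∉ S)) →
    ∃ S' : Finset (Site 2), S'.card ≤ 5 * S.card ∧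
      (∀ x y : Site 2, (discreteDomainGraph (dom C δ) δ).Adj x y ↔
        ((discreteDomainGraph Ω δ).Adj x y ∧ x ∉ S' ∧ y ∉ S')) ∧
      (∀ y w : Site 2, y ∉ S' → (discreteDomainGraph Ω δ).Adj y w →
        ∃ w', (discreteDomainGraph Ω δ).Adj y w' ∧ w' ∉ S') ∧
      ((∀ k ∈ S', ∃ (q : Site 2) (p : (zdGraph 2).Walk k q), q ∈ C.support ∧
          ∀ z ∈ p.support, z ∈ S' ∨ z ∈ C.support) ∨
        (∃ k : Site 2, (∃ w, (discreteDomainGraph Ω δ).Adj k w) ∧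
          ∀ y, (discreteDomainGraph Ω δ).Reachable k y → y ∈ S')) := by
  intro Ω δ c C S hδ hid
  classical
  obtain ⟨S₂, hcard, hid₂, hcl₂, hedge⟩ := tamePresentation_close Ω δ C S hid
  set G := discreteDomainGraph Ω δ with hG
  have hle : G ≤ zdGraph 2 := (discreteDomainGraph_le_meshGraph Ω δ).trans (meshGraph_le_zdGraph Ω δ)
  refine ⟨S₂, hcard, hid₂, hcl₂, ?_⟩
  -- a site of `S₂` with a neighbour off `S₂` is a trace site
  have htrace : ∀ s ∈ S₂, ∀ y, y ∉ S₂ → G.Adj s y → s ∈ C.support := by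
    intro s hs y hy hsy
    obtain ⟨z, hyz, hz⟩ := hcl₂ y s hy hsy.symm
    have hyz' : (discreteDomainGraph (dom C δ) δ).Adj y z := (hid₂ y z).2 ⟨hyz, hy, hz⟩
    rcases adj_or_mem_support C hδ hyz' (hle hsy.symm) with h | h
    · exact h
    · exact absurd hs ((hid₂ y s).1 h).2.2
  by_cases hA : ∀ s ∈ S₂, ∃ (s' : Site 2) (p : G.Walk s s'),
      (∃ y, y ∉ S₂ ∧ G.Adj s' y) ∧ ∀ z ∈ p.support, z ∈ S₂
  · -- attached
    left
    intro k hk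
    obtain ⟨s', p, ⟨y, hy, hs'y⟩, hsupp⟩ := hA k hk
    have hs'S : s' ∈ S₂ := hsupp s' p.end_mem_support
    refine ⟨s', p.mapLe hle, htrace s' hs'S y hy hs'y, fun z hz => Or.inl (hsupp z ?_)⟩
    rwa [SimpleGraph.Walk.support_mapLe_eq_support] at hz
  · -- swallowing: the `S₂`-internal component of `k` is a whole reachability class
    right
    simp only [not_forall, not_exists, not_and] at hA
    obtain ⟨k, hk, hstuck⟩ := hA
    refine ⟨k, hedge k hk, ?_⟩
    -- every walk into `k` starts in `S₂`, with an `S₂`-internal walk back from `k`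
    have key : ∀ {y t : Site 2} (q : G.Walk y t), t = k → ∃ p : G.Walk k y, ∀ z ∈ p.support, z ∈ S₂ := by
      intro y t q
      induction q with
      | nil =>
        rintro rfl
        exact ⟨SimpleGraph.Walk.nil, fun z hz => by
          rw [SimpleGraph.Walk.support_nil, List.mem_singleton] at hz
          exact hz ▸ hk⟩
      | @cons y₀ y₁ _ hadj q₁ ih =>
        rintro rfl
        obtain ⟨p, hp⟩ := ih rfl
        have hy₁ : y₁ ∈ S₂ := hp y₁ p.end_mem_support
        have hy₀ : y₀ ∈ S₂ := by
          by_contra h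
          obtain ⟨z, hz, hzS⟩ := hstuck y₁ p ⟨y₀, h, hadj.symm⟩
          exact hzS (hp z hz)
        refine ⟨p.concat hadj.symm, fun z hz => ?_⟩
        rw [SimpleGraph.Walk.support_concat, List.mem_append, List.mem_singleton] at hz
        rcases hz with hz | rfl
        · exact hp z hz
        · exact hy₀
    intro y hy
    obtain ⟨q⟩ := hy.symm
    obtain ⟨p, hp⟩ := key q rfl
    exact hp y p.end_mem_support

end Summit.CriticalPhenomena.SAWScalingLimit.Theorems.FKGToTraversalBound.SlitNecklace

end
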